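import Summits.QuantumFields.BalabanUV.T4Continuum.Support.NE9SizeFedCouplingSpecies
import Summits.QuantumFields.BalabanUV.T4Continuum.Support.NE9CurveSpeciesWitness
import Summits.QuantumFields.BalabanUV.T4Continuum.Support.NE9KernelSpeciesWitness

/-!
# NE9SizeFedCouplingSpeciesWitness — JOINT NON-VACUITY of the species-level A3 producer: `NE9SizeFedCouplingSpecies.tcup_species_proj`
# (p215986) FIRES on ONE toy carrying BOTH species — the curve toy `wCur γ` (CUR-WITNESS, leaf-06-g8, genuinely non-linear slice
# curve) and the kernel toy `wKer γ` (KER-WITNESS, leaf-09-g6) on `toyCarriers` with the family `wE γ` (REM-WITNESS, leaf-09-g5) —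
# the three identification binders of the assembled END DISCHARGED by `rfl`, at the identity projection AND at a step-wise
# projection of genuine cost (`H ↦ 2•H`, c = 1)
# (cell `pub-balaban`, T4-DAG §2 node U3 ∕ §6 NE9; NE9 formalisation swarm, unit `b2b-balaban-t4-ne9-formalise-leaf-05` gen 6;
# own-lineage follow-through «SPECIES-A3-WITNESS» of «A3-FED-SPECIES», CLAIMS.log (this module's CLAIM line); at own risk)

HONEST FRAMING (T4-DAG PAGE 1).  Rung (B)+1 of the FINITE-VOLUME T⁴ programme — NOT infinite volume, NOT a mass gap, NOT the
Clay problem.  NE9 (`T4OutputRate.NE9` ∧ `FadingMemory`) is a cell NEW ESTIMATE, NOT PRINTED, NOT discharged here («NE9 ⇐ the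
named binders»); spine 0∕9; 0∕18 skeleton leaves instantiated on Bałaban's objects (O-NE9-1).  HONEST DEPENDENCY (cell line,
verbatim): continuum YM on T⁴ ⇐ BetaPertH ∧ nine spine estimates (0/9 proved); BetaPertH ⇐ (D1) ∧ (D4) ∧ CAP+tail; G-an2-4
gates asym, D1 and NE2/3/4.  A LABELLED TOY: nothing here is, or is claimed to be, an object of [Balaban1987RG1] ∕
[Balaban1988RG2Cluster]; the two papers are cited for the TYPES the toy inhabits, nothing printed is asserted (ABSOLUTE RULE).
No Prop-valued definition; `FlowStep.BetaPertH`, (B), (B^μ) do not occur.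

WHAT THIS FILE IS.  The assembled-species A3 producer `tcup_species_proj` (A3-FED-SPECIES §2) carries ≈ 30 binders: the
projection's `AdmRestrict` ∕ `ProjScaleComm` ∕ `ProjSize` ∕ admissibility ∕ analyticity, species (a)'s `CurData.Admissible` +
(c1)–(c3) + counts, species (b)'s `KerData.Admissible` + (C) + (K-Lip) + counts AT A SECOND RATE, and the identification binders
`hκ₁` ∕ `hR` ∕ `hdY` of the owner's p215007 (ONE κ₁, ONE set of radii, ONE output geometry read by two data), with ONE common
(1.28)-constant O1, ONE rate letter ω and ONE size profile.  The three species witnesses in the tree inhabit the (a)-side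
(CUR-WITNESS p215223), the (b)-side (KER-WITNESS p215103) and the family (REM-WITNESS p213736) SEPARATELY.  THIS FILE checks the
JOINT list: §1 the identification binders hold between `wKer γ` and `wCur γ` by `rfl` (both were built on REM-WITNESS's index
frame), and the identity ∕ doubling projections meet the projection quadruple on the analytic class; §2 **`tcup_species_witness_id`**
— the producer APPLIED BY NAME at `P := id` (c = 0), fed with `termSize_wE`; §3 **`tcup_species_witness_double`** — the same at
the doubling projection `P := fun H => (2:ℝ) • H` (c = 1: `termSize_proj` runs with a genuine cost factor, the projected family's
analyticity comes from `smul_mem_analyticClass`).  Every binder is supplied by a NAMED toy theorem of the three witness modules or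
by `rfl` ∕ `norm_num`; the conclusions are the producer's at the toy letters (`clip = 1∕2`, `λ = 1`, `cQ_(a) = cQ_(b) = 1`,
`O1 = 2`, `N̄ = γ`, `w = 0`).  DISGUISE TEST: a toy; not NE9, not an instantiation on Bałaban's run.

WHAT IS PROVED (kernel, `[folklore]`; 0 sorry, 0 `def`): `kappa1_wKer_wCur`, `radius_wKer_wCur`, `dY_wKer_wCur`,
`projScaleComm_id`, `projSize_id`, `restrictScale_smul`, `projScaleComm_smul`, `projSize_two_smul`, `tcup_species_witness_id`,
`tcup_species_witness_double`.

References (TYPES only): [Balaban1987RG1] T. Bałaban, CMP **109** (1987) 249–301, (1.3) p. 260, (1.18) p. 263, (3.53)–(3.54)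
p. 280, (4.22) p. 286; [Balaban1988RG2Cluster] T. Bałaban, CMP **116** (1988) 1–22, (1.21)–(1.29) pp. 7–8, (2.14)–(2.15) p. 15.
Summits-side NEW work (LEAN PLACEMENT RULE); imports A3-FED-SPECIES (p215986), CUR-WITNESS (p215223), KER-WITNESS (p215103) BY
NAME; modifies nothing.  Value = a non-vacuity ∕ compatibility certificate for one producer's binder list, NOT summit progress.
-/

noncomputable section

namespace Summit.QuantumFields.BalabanUV.T4Continuum.NE9SizeFedCouplingSpeciesWitness

open scoped BigOperators
open Metric Set
open Literature.MathematicalPhysics.QuantumFieldTheory.Balaban1983to89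
open Literature.MathematicalPhysics.QuantumFieldTheory.Balaban1983to89.T4OutputRate
open Literature.MathematicalPhysics.QuantumFieldTheory.Balaban1983to89.T4HistoryLipschitzRecursion
open Literature.MathematicalPhysics.QuantumFieldTheory.Balaban1983to89.T4HistoryLipschitzSegment
open Summit.QuantumFields.BalabanUV.T4Continuum.NE9Lemma1Counting
open Summit.QuantumFields.BalabanUV.T4Continuum.NE9Lemma1Gain
open Summit.QuantumFields.BalabanUV.T4Continuum.NE9Lemma1PieceClass
open Summit.QuantumFields.BalabanUV.T4Continuum.NE9Lemma1RemainderSpecies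
open Summit.QuantumFields.BalabanUV.T4Continuum.NE9Lemma1CurveSpecies
open Summit.QuantumFields.BalabanUV.T4Continuum.NE9Lemma1KernelSpecies
open Summit.QuantumFields.BalabanUV.T4Continuum.NE9ComplexEncoding (doubleCarriers)
open Summit.QuantumFields.BalabanUV.T4Continuum.NE9MarginalProjection
open Summit.QuantumFields.BalabanUV.T4Continuum.NE9RemainderSpeciesMargProj (smul_mem_analyticClass)
open Summit.QuantumFields.BalabanUV.T4Continuum.NE9RemainderSpeciesWitness
open Summit.QuantumFields.BalabanUV.T4Continuum.NE9CurveSpeciesWitness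
open Summit.QuantumFields.BalabanUV.T4Continuum.NE9KernelSpeciesWitness
open Summit.QuantumFields.BalabanUV.T4Continuum.NE9SizeFedCouplingSpecies (termSize_proj tcup_species_proj)

/-! ## §1 The identification binders on the toys, and the projection quadruple for `id` ∕ `2 • ·` -/

/-- `hκ₁` on the toys: the kernel toy and the curve toy carry the SAME κ₁ (= 1). [folklore] -/
theorem kappa1_wKer_wCur (γ : ℝ) : (wKer γ).κ₁ = (wCur γ).κ₁ := rfl

/-- `hR` on the toys: the SAME analyticity radii (≡ 1). [folklore] -/
theorem radius_wKer_wCur (γ : ℝ) : (wKer γ).R = (wCur γ).R := rfl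

/-- `hdY` on the toys: the SAME output geometry `d_k(Y)` (≡ 0). [folklore] -/
theorem dY_wKer_wCur (γ : ℝ) : (wKer γ).toC.frame.dY = (wCur γ).toC.frame.dY := by
  -- unfold first, so that the kernel never compares the two data's (different) `piece` fields (cf. KER-WITNESS `frame_wKer`)
  unfold CPieceData.frame KerData.toC CurData.toC wKer wCur
  rfl

section Proj

variable {C : Carriers} {Bg : Type}

/-- The identity projection acts step by step. [folklore] -/
theorem projScaleComm_id (Adm : Set (Bg → C.Dom → ℝ)) : ProjScaleComm Adm id := fun _ _ _ => rfl

/-- The identity projection costs nothing (`c = 0`). [folklore] -/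
theorem projSize_id (Adm : Set (Bg → C.Dom → ℝ)) (κ : ℝ) : ProjSize Adm id κ 0 := by
  intro j H _ _ N _ hb U X hX
  rw [zero_add_one_mul]
  exact hb U X hX
where
  /-- `(1 + 0)·N = N`, in the shape `ProjSize` prints. [folklore] -/
  zero_add_one_mul {N : ℝ} {e : ℝ} : e * ((1 + 0) * N) = e * N := by ring

/-- Restriction to a creation step commutes with real multiples. [folklore] -/
theorem restrictScale_smul (j : ℕ) (c : ℝ) (H : Bg → C.Dom → ℝ) : restrictScale j (c • H) = c • restrictScale j H := by
  funext U X
  by_cases hX : C.scale X = j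
  · rw [restrictScale_of_eq _ hX, Pi.smul_apply, Pi.smul_apply, Pi.smul_apply, Pi.smul_apply, restrictScale_of_eq _ hX]
  · rw [restrictScale_of_ne _ hX, Pi.smul_apply, Pi.smul_apply, restrictScale_of_ne _ hX, smul_zero]

/-- A real-multiple projection `H ↦ c • H` acts step by step. [folklore] -/
theorem projScaleComm_smul (Adm : Set (Bg → C.Dom → ℝ)) (c : ℝ) : ProjScaleComm Adm (fun H => c • H) :=
  fun H _ j => (restrictScale_smul j c H).symm

/-- The doubling projection `H ↦ 2 • H` costs the factor `1 + 1`. [folklore] -/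
theorem projSize_two_smul (Adm : Set (Bg → C.Dom → ℝ)) (κ : ℝ) : ProjSize Adm (fun H => (2:ℝ) • H) κ 1 := by
  intro j H _ _ N _ hb U X hX
  have h := hb U X hX
  show |(2:ℝ) * H U X| ≤ Real.exp (-(κ * C.d X)) * ((1 + 1) * N)
  rw [abs_mul, abs_two]
  nlinarith [Real.exp_pos (-(κ * C.d X))]

end Proj

/-! ## §2 The producer FIRES on the toy pair at the identity projection -/

/-- **`tcup_species_proj` FIRES ON THE TOY PAIR (`P := id`, kernel).**  For `0 ≤ γ ≤ 1`, any window `W`, any `κ`, `0 ≤ ω < 1`: the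
assembled-species A3 producer applied BY NAME to `D := wCur γ`, `K := wKer γ`, `Ef := wE γ`, `Adm := analyticClass (wCur γ).R`,
`N ≡ N̄ := γ`, `c := 0`, with the toy theorems of CUR-WITNESS ∕ KER-WITNESS ∕ REM-WITNESS for every species binder, `rfl` for the
three identification binders, and its `TermSize` antecedent fed by `termSize_wE`.  Toy letters: `clip = 1∕2`, `c_dir = 1∕4`,
`ℓ ≡ 1`, `λ = cK = 1`, `w = 0`, `O1 = 2`, `cQ_(a) = cQ_(b) = 1`, `d₀ = 0`. [folklore] -/
theorem tcup_species_witness_id {γ : ℝ} (hγ0 : 0 ≤ γ) (hγ1 : γ ≤ 1) (W : Set (ℕ → ℝ)) (κ : ℝ) {ω : ℝ} (hω0 : 0 ≤ ω)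
    (hω1 : ω < 1) :
    ∀ g ∈ W, ∀ g' ∈ W, ∀ (k : ℕ) (y : Unit),
      |compProj (cpieceChannel (wCur γ).toC + cpieceChannel (wKer γ).toC) id k g (wE γ g) y -
          compProj (cpieceChannel (wCur γ).toC + cpieceChannel (wKer γ).toC) id k g' (wE γ g) y| ≤
        weightOf (wCur γ).toC.frame (wCur γ).κ₁ 0 2 ((wCur γ).Kp (1 / 4) + (wKer γ).Kp 1 0
          ((2 / (1 - Real.exp (-((1 / 2 : ℝ) / ((4 : ℕ) : ℝ))))) ^ (4 : ℕ))
          ((2 * ((1 : ℕ) : ℝ) / (Real.exp 1 * (1 / 2 : ℝ))) ^ (1 : ℕ) *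
            (2 / (1 - Real.exp (-((1 / 2 : ℝ) / 2 / ((4 : ℕ) : ℝ))))) ^ (4 : ℕ))) k y *
          ((64 * (1 / 2) * 1 + 1 * 1) * ((1 + 0) * γ) * (1 - ω)⁻¹ * |g k - g' k|) :=
  tcup_species_proj (Adm := analyticClass (wCur γ).R) (N := fun _ => γ) (Nbar := γ) (clip := 1 / 2) (lam := 1) (c := 0)
    (admRestrict_analyticClass _) (projScaleComm_id _) (projSize_id _ κ) le_rfl (fun g _ => wE_mem_analyticClass_cur γ g)
    (fun g _ => wE_mem_analyticClass_cur γ g) (fun _ => hγ0) (fun _ => le_rfl)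
    (admissible_wCur hγ0 hγ1) (by norm_num) (by norm_num) (fun _ _ => one_pos) (fun _ _ => by norm_num)
    (cur_contourContinuous_wCur γ) (cur_couplingLipschitz_wCur γ W) (cur_room_wCur hγ0 hγ1 W) (levelCountsG_wCur γ κ hω0)
    (admissible_wKer hγ0 hγ1) (kappa1_wKer_wCur γ) (radius_wKer_wCur γ) (dY_wKer_wCur γ) zero_le_one (kerC_wKer γ)
    (kerL_wKer γ W) (levelCountsG_wKer γ (κ - 0) hω0) zero_le_two zero_le_one zero_le_one hω0 hω1 (termSize_wE hγ0 W κ)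

/-! ## §3 The producer FIRES at a projection of genuine cost (`H ↦ 2 • H`, c = 1) -/

/-- **`termSize_proj` RUNS WITH A GENUINE COST FACTOR on the toy**: the doubled family `g ↦ 2 • wE γ g` obeys
`TermSize … ((1 + 1)·γ)` — A3-FED-SPECIES §1 applied with `projScaleComm_smul` ∕ `projSize_two_smul`. [folklore] -/
theorem termSize_double_wE {γ : ℝ} (hγ0 : 0 ≤ γ) (W : Set (ℕ → ℝ)) (κ : ℝ) :
    TermSize (fun g => (2:ℝ) • wE γ g) W κ (fun _ => (1 + 1) * γ) :=
  termSize_proj (Adm := analyticClass (wCur γ).R) (N := fun _ => γ) (admRestrict_analyticClass _) (projScaleComm_smul _ 2)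
    (projSize_two_smul _ κ) (fun g _ => wE_mem_analyticClass_cur γ g) (fun _ => hγ0) (termSize_wE hγ0 W κ)

/-- **`tcup_species_proj` FIRES ON THE TOY PAIR AT THE DOUBLING PROJECTION (`P := fun H => 2 • H`, c = 1, kernel).**  As §2, with the
projected family's analyticity from `smul_mem_analyticClass` and the cost factor `1 + 1` carried into the constant. [folklore] -/
theorem tcup_species_witness_double {γ : ℝ} (hγ0 : 0 ≤ γ) (hγ1 : γ ≤ 1) (W : Set (ℕ → ℝ)) (κ : ℝ) {ω : ℝ} (hω0 : 0 ≤ ω)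
    (hω1 : ω < 1) :
    ∀ g ∈ W, ∀ g' ∈ W, ∀ (k : ℕ) (y : Unit),
      |compProj (cpieceChannel (wCur γ).toC + cpieceChannel (wKer γ).toC) (fun H => (2:ℝ) • H) k g (wE γ g) y -
          compProj (cpieceChannel (wCur γ).toC + cpieceChannel (wKer γ).toC) (fun H => (2:ℝ) • H) k g' (wE γ g) y| ≤
        weightOf (wCur γ).toC.frame (wCur γ).κ₁ 0 2 ((wCur γ).Kp (1 / 4) + (wKer γ).Kp 1 0
          ((2 / (1 - Real.exp (-((1 / 2 : ℝ) / ((4 : ℕ) : ℝ))))) ^ (4 : ℕ))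
          ((2 * ((1 : ℕ) : ℝ) / (Real.exp 1 * (1 / 2 : ℝ))) ^ (1 : ℕ) *
            (2 / (1 - Real.exp (-((1 / 2 : ℝ) / 2 / ((4 : ℕ) : ℝ))))) ^ (4 : ℕ))) k y *
          ((64 * (1 / 2) * 1 + 1 * 1) * ((1 + 1) * γ) * (1 - ω)⁻¹ * |g k - g' k|) :=
  tcup_species_proj (Adm := analyticClass (wCur γ).R) (N := fun _ => γ) (Nbar := γ) (clip := 1 / 2) (lam := 1) (c := 1)
    (admRestrict_analyticClass _) (projScaleComm_smul _ 2) (projSize_two_smul _ κ) zero_le_one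
    (fun g _ => wE_mem_analyticClass_cur γ g) (fun g _ => smul_mem_analyticClass (wE_mem_analyticClass_cur γ g) 2)
    (fun _ => hγ0) (fun _ => le_rfl)
    (admissible_wCur hγ0 hγ1) (by norm_num) (by norm_num) (fun _ _ => one_pos) (fun _ _ => by norm_num)
    (cur_contourContinuous_wCur γ) (cur_couplingLipschitz_wCur γ W) (cur_room_wCur hγ0 hγ1 W) (levelCountsG_wCur γ κ hω0)
    (admissible_wKer hγ0 hγ1) (kappa1_wKer_wCur γ) (radius_wKer_wCur γ) (dY_wKer_wCur γ) zero_le_one (kerC_wKer γ)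
    (kerL_wKer γ W) (levelCountsG_wKer γ (κ - 0) hω0) zero_le_two zero_le_one zero_le_one hω0 hω1 (termSize_wE hγ0 W κ)

/-- The window may be EVERYTHING and the rate letter any `ω ∈ [0,1)`: the binder list is inhabited with `W := univ`, `γ := 1`,
`κ := 144`, `ω := 1∕2` (non-degenerate letters). [folklore] -/
example : ∀ g ∈ (univ : Set (ℕ → ℝ)), ∀ g' ∈ (univ : Set (ℕ → ℝ)), ∀ (k : ℕ) (y : Unit),
    |compProj (cpieceChannel (wCur 1).toC + cpieceChannel (wKer 1).toC) id k g (wE 1 g) y -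
        compProj (cpieceChannel (wCur 1).toC + cpieceChannel (wKer 1).toC) id k g' (wE 1 g) y| ≤
      weightOf (wCur 1).toC.frame (wCur 1).κ₁ 0 2 ((wCur 1).Kp (1 / 4) + (wKer 1).Kp 1 0
        ((2 / (1 - Real.exp (-((1 / 2 : ℝ) / ((4 : ℕ) : ℝ))))) ^ (4 : ℕ))
        ((2 * ((1 : ℕ) : ℝ) / (Real.exp 1 * (1 / 2 : ℝ))) ^ (1 : ℕ) *
          (2 / (1 - Real.exp (-((1 / 2 : ℝ) / 2 / ((4 : ℕ) : ℝ))))) ^ (4 : ℕ))) k y *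
        ((64 * (1 / 2) * 1 + 1 * 1) * ((1 + 0) * 1) * (1 - (1 / 2 : ℝ))⁻¹ * |g k - g' k|) :=
  tcup_species_witness_id zero_le_one le_rfl univ 144 (by norm_num) (by norm_num)

end Summit.QuantumFields.BalabanUV.T4Continuum.NE9SizeFedCouplingSpeciesWitness

end
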